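import Summits.QuantumFields.YangMills.Theorems.QuantileBitPurityQuantileBit
import Summits.QuantumFields.YangMills.Theorems.SwapTwistDeficitSmallBallFloors
import HarnessLib

/-!
# One-step persistence of the quantile bit on the window `L ≤ β^a`

Support module for the door `QuantileBitPurity.QuantileBitDoor` (item stmt-QuantumFields-23925, LINE g12-B of seat ym-idea-4; target leaf
`ThermalTraceWindow.SubFemtoTraceRatio`).  ★ `bit_one_step_ge`: for `0 < a ≤ 1`, `γ < 1/2 − 3a`, `β ≥ β₁`, every lattice `L = n+1 ≥ 2` with `L ≤ β^a`
and every centre `c`, a Lévy bound `weight{|polDist − c| ≤ β^{−γ}} ≤ β^{−a} Z_phys(L)` on the ring of `L` transfer kernels gives the one-step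
autocorrelation `Tr(O_c T O_c T^{L−1}) ≥ (1 − 3β^{−a}) Z_phys(L)` of the quantile bit `O_c = 1 − 2·𝟙{polDist ≤ c}`: persistence along the ring
(`TT.ringInsTrace_one_ge_of_persistence` with the pointwise inequality `one_sub_le_bit_mul`), the far link costing `β^{−a−3}` against the explicit
floor `Z_phys(L) ≥ (e^{2β|E|}β^{−N})^L` (`TT.levelValue_zero_ge_rpow`, trace formula), the strip width `L t ≤ β^{−γ}` (`TT.stripWidth_le_rpow`) — the
ring-of-`L` copy of the displacement half of `SwapTwistDeficit.stepPersistence_window_of_smallBall`.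

HONEST FRAMING: fixed-lattice bookkeeping for a door of a DRAFT line onto a RECORD rung (K2); no summit / rung statement is proved; the YM mass gap is
NOT proved.  No `sorry`, no new axiom, no new definition.  References: [cite: MadrasSokal1988, §2]; [cite: SeilerLNP1982, §3]; [cite: Luscher1983, §2];
[cite: MontvayMunster1994, (3.145)].
-/

set_option autoImplicit false

noncomputable section

open MeasureTheory Filter Topology Real Function
open scoped Matrix ComplexConjugate BigOperators
open Literature.MathematicalPhysics.QuantumLattice
open Literature.MathematicalPhysics.QuantumFieldTheory hiding SU2
open Summit.QuantumFields.YangMills.Theorems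

namespace Summit.QuantumFields.YangMills.Theorems.QuantileBitPurity

open Summit.QuantumFields.YangMills.Theorems.FemtoTransferGap
open Summit.QuantumFields.YangMills.Theorems.FemtoTransferGap.FlatSheet
open Summit.QuantumFields.YangMills.Theorems.FemtoTransferGap.TT

/-! ## §1 One-step persistence of the quantile bit on the window -/

set_option maxHeartbeats 800000 in
/-- ★ **One-step persistence of the quantile bit.**  Let `0 < a ≤ 1` and `γ < 1/2 − 3a`.  There is `β₁ ≥ 9` such that for `β ≥ β₁`, every lattice
`L = n + 1 ≥ 2` with `L ≤ β^a` and every centre `c`: if the slice weight of `{|polDist − c| ≤ β^{−γ}}` on the ring of `L` kernels is at most `β^{−a} Z_phys(L)`,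
then the quantile bit `O_c = 1 − 2·𝟙{polDist ≤ c}` has `ringInsTrace L β (L−1) O_c 1 ≥ (1 − 3β^{−a}) Z_phys(L)` (persistence along the ring, the far
link costing `β^{−a−3}` against the floor `Z_phys(L) ≥ (e^{2β|E|}β^{−N})^L`, the strip width `L t ≤ β^{−γ}`). [cite: MadrasSokal1988, §2] [cite: SeilerLNP1982, §3] -/
theorem bit_one_step_ge {a γ : ℝ} (ha : 0 < a) (ha1 : a ≤ 1) (hγ : γ < 1 / 2 - 3 * a) :
    ∃ β₁ : ℝ, 9 ≤ β₁ ∧ ∀ β : ℝ, β₁ ≤ β → ∀ n : ℕ, 1 ≤ n → (((n + 1 : ℕ) : ℝ)) ≤ β ^ a → ∀ c : ℝ,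
      ringInsTrace (n + 1) β n ({U : GaugeConfig 3 (n + 1) SU2 | |polDist U - c| ≤ β ^ (-γ)}.indicator fun _ => (1 : ℝ)) 0 ≤
          β ^ (-a) * physTrace (n + 1) β (n + 1) →
        (1 - 3 * β ^ (-a)) * physTrace (n + 1) β (n + 1) ≤
          ringInsTrace (n + 1) β n (fun U => 1 - 2 * {U : GaugeConfig 3 (n + 1) SU2 | polDist U ≤ c}.indicator (fun _ => (1 : ℝ)) U) 1 := by
  obtain ⟨β₁, hβ₁9, hwidth⟩ := TT.stripWidth_le_rpow ha ha1 hγ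
  set w₀ : ℝ := Real.exp (-(1 / 2 : ℝ)) * (8 / (3 * π ^ 3)) with hw₀
  refine ⟨max β₁ (4 / w₀), le_max_of_le_left hβ₁9, fun β hβ n hn hLβ c hSB => ?_⟩
  have hββ₁ : β₁ ≤ β := (le_max_left _ _).trans hβ
  have hβw : 4 / w₀ ≤ β := (le_max_right _ _).trans hβ
  have hβ9 : 9 ≤ β := hβ₁9.trans hββ₁
  have hβ1 : 1 ≤ β := by linarith
  have hβ0 : 0 < β := by linarith
  -- data
  set E : ℕ := Fintype.card (Edge 3 (n + 1)) with hE
  set P : ℕ := Fintype.card (Plaquette 3 (n + 1)) with hP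
  set N : ℕ := 8 * P + 97 * E with hN
  set M : ℝ := Real.exp (2 * β) ^ E with hM
  set Z : ℝ := physTrace (n + 1) β (n + 1) with hZ
  set cc : ℝ := a + 2 * ((n + 1 : ℕ) : ℝ) * (8 * (P : ℝ) + 97 * (E : ℝ)) + 3 with hcc
  set t : ℝ := Real.sqrt (2 * cc * Real.log β / β) with ht
  have hM0 : 0 < M := by positivity
  have hlog0 : 0 ≤ Real.log β := Real.log_nonneg hβ1
  have hcc0 : 0 ≤ cc := by rw [hcc]; positivity
  have ht0 : 0 ≤ t := Real.sqrt_nonneg _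
  have hZdef : physTraceSucc (n + 1) β n = Z := rfl
  -- the floor `Z ≥ λ₀^{n+1} ≥ (M β^{-N})^{n+1}`
  have hlam : M * (β ^ N)⁻¹ ≤ levelValue su2Rep (n + 1) β 0 := TT.levelValue_zero_ge_rpow hβ9 hβw
  have hZS := traceFormula (n + 1) β (n + 1) hβ1 (by omega)
  have hlamZ : levelValue su2Rep (n + 1) β 0 ^ (n + 1) ≤ Z := le_hasSum hZS 0 fun k _ => pow_nonneg (levelValue_su2Rep_pos hβ0 k).le _
  have hfloor : (M * (β ^ N)⁻¹) ^ (n + 1) ≤ Z := (pow_le_pow_left₀ (by positivity) hlam _).trans hlamZ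
  have hZpos : 0 < Z := lt_of_lt_of_le (pow_pos (by positivity) _) hfloor
  -- the bit and the strip
  set O : GaugeConfig 3 (n + 1) SU2 → ℝ := fun U => 1 - 2 * {U : GaugeConfig 3 (n + 1) SU2 | polDist U ≤ c}.indicator (fun _ => (1 : ℝ)) U with hO
  have hOP : IsPhys O := isPhys_bit c
  have hOb : ∀ U, |O U| ≤ 1 := abs_bit_le_one c
  set A : Set (GaugeConfig 3 (n + 1) SU2) := {U | |polDist U - c| ≤ ((n + 1 : ℕ) : ℝ) * t} with hA
  have hAm : MeasurableSet A := measurableSet_polDist_near c _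
  have hpers := ringInsTrace_one_ge_of_persistence (L := n + 1) hn hβ0.le hOP.measurable hOb hAm ht0 (fun U V => one_sub_le_bit_mul c t U V)
  rw [hZdef] at hpers
  -- (i) the strip term
  have hwid : 2 * ((n + 1 : ℕ) : ℝ) * t ≤ β ^ (-γ) := by
    have h := hwidth β hββ₁ (n + 1) hLβ
    simpa only [ht, hcc] using h
  have hAB : A ⊆ {U | |polDist U - c| ≤ β ^ (-γ)} := fun U hU => by
    have hU' : |polDist U - c| ≤ ((n + 1 : ℕ) : ℝ) * t := hU
    have hpos : 0 ≤ ((n + 1 : ℕ) : ℝ) * t := by positivity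
    exact hU'.trans (by linarith)
  have hstrip : ringInsTrace (n + 1) β n (A.indicator fun _ => (1 : ℝ)) 0 ≤ β ^ (-a) * Z :=
    (ringInsTrace_indicator_zero_mono hβ0.le n hAm (measurableSet_polDist_near c _) hAB).trans hSB
  -- (ii) the far term: `η M^{n-1} M = β^{-cc} M^{n+1}`
  have hβt : β * t ^ 2 / 2 = cc * Real.log β := by
    have h2 : t ^ 2 = 2 * cc * Real.log β / β := by rw [ht, Real.sq_sqrt (by positivity)]
    rw [h2]; field_simp
  have eExp : Real.exp (-(β * t ^ 2 / 2)) = β ^ (-cc) := by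
    rw [hβt, Real.rpow_def_of_pos hβ0]; congr 1; ring
  have eM : Real.exp (β * (2 * (E : ℝ) - t ^ 2 / 2)) = M * Real.exp (-(β * t ^ 2 / 2)) := by
    rw [hM, ← Real.exp_nat_mul, ← Real.exp_add]; congr 1; ring
  have hη : Real.exp (β * (2 * (E : ℝ) - t ^ 2 / 2)) * M ^ (n - 1) * M = β ^ (-cc) * M ^ (n + 1) := by
    rw [eM, eExp]
    have e2 : M ^ (n + 1) = M * M ^ (n - 1) * M := by
      have h : M ^ (n + 1) = M ^ (n - 1) * M ^ 2 := by rw [← pow_add]; congr 1; omega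
      rw [h]; ring
    rw [e2]; ring
  have hNc : β ^ (-cc) = β ^ (-a) * ((β ^ N) ^ (2 * (n + 1)))⁻¹ * β ^ (-(3 : ℝ)) := by
    rw [hcc, show -(a + 2 * ((n + 1 : ℕ) : ℝ) * (8 * (P : ℝ) + 97 * (E : ℝ)) + 3) = -a + -(((2 * (n + 1) * N : ℕ) : ℝ)) + -(3 : ℝ) by
        rw [hN]; push_cast; ring,
      Real.rpow_add hβ0, Real.rpow_add hβ0, Real.rpow_neg hβ0.le (((2 * (n + 1) * N : ℕ) : ℝ)), Real.rpow_natCast, mul_comm (2 * (n + 1)) N,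
      pow_mul]
  have hβ3 : β ^ (-(3 : ℝ)) ≤ 1 / 8 := by
    rw [Real.rpow_neg hβ0.le, show (3 : ℝ) = ((3 : ℕ) : ℝ) by norm_num, Real.rpow_natCast, inv_eq_one_div]
    have h8 : (8 : ℝ) ≤ β ^ 3 := by
      have h2 : (2 : ℝ) ≤ β := by linarith
      calc (8 : ℝ) = 2 ^ 3 := by norm_num
        _ ≤ β ^ 3 := pow_le_pow_left₀ (by norm_num) h2 3
    exact div_le_div_of_nonneg_left zero_le_one (by norm_num) h8
  have hNN : ((β ^ N) ^ (2 * (n + 1)))⁻¹ ≤ ((β ^ N) ^ (n + 1))⁻¹ := by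
    have h1 : 1 ≤ β ^ N := one_le_pow₀ hβ1
    have hpos : 0 < (β ^ N) ^ (n + 1) := by positivity
    exact inv_anti₀ hpos (pow_le_pow_right₀ h1 (by omega))
  have hfar : 2 * (Real.exp (β * (2 * (E : ℝ) - t ^ 2 / 2)) * M ^ (n - 1) * M) ≤ β ^ (-a) / 4 * Z := by
    rw [hη, hNc]
    have hpos1 : 0 ≤ β ^ (-a) := Real.rpow_nonneg hβ0.le _
    have hkey : ((β ^ N) ^ (n + 1))⁻¹ * M ^ (n + 1) ≤ Z := by
      rw [← inv_pow, ← mul_pow, mul_comm]; exact hfloor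
    have hkey2 : ((β ^ N) ^ (2 * (n + 1)))⁻¹ * M ^ (n + 1) ≤ Z :=
      (mul_le_mul_of_nonneg_right hNN (by positivity)).trans hkey
    calc 2 * (β ^ (-a) * ((β ^ N) ^ (2 * (n + 1)))⁻¹ * β ^ (-(3 : ℝ)) * M ^ (n + 1))
        = 2 * β ^ (-a) * β ^ (-(3 : ℝ)) * (((β ^ N) ^ (2 * (n + 1)))⁻¹ * M ^ (n + 1)) := by ring
      _ ≤ 2 * β ^ (-a) * (1 / 8) * Z := mul_le_mul (mul_le_mul_of_nonneg_left hβ3 (by positivity)) hkey2 (by positivity) (by positivity)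
      _ = β ^ (-a) / 4 * Z := by ring
  -- (iii) combine
  have h := hpers
  nlinarith [h, hstrip, hfar, Real.rpow_nonneg hβ0.le (-a), hZpos]

end Summit.QuantumFields.YangMills.Theorems.QuantileBitPurity

end
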